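import Literature.NumberTheory.EllipticCurves.ThreeTorsionRadicalsProofs
import Literature.NumberTheory.EllipticCurves.DivisionPolynomialTorsion
import HarnessLib

/-!
# The eight points of `E[3] ∖ O` by radicals

`Proofs` file (theorems only, no definitions, no named facts) in topic
`NumberTheory/EllipticCurves`, sequel of `ThreeTorsionRadicalsProofs` (same seat, bsd.S15: the
Galois side of Ogg's formula at the places above `2`, Silverman *ATAEC* IV.11.1, `p = 2`).

With `ω² + ω + 1 = 0`, `U_k² = A_k = c₄ - 12ωᵏδ` and `U₀U₁U₂ = c₆` as there, let
`z_{+++} = U₀ + U₁ + U₂`, `z_{+--} = U₀ - U₁ - U₂`, `z_{-+-} = -U₀ + U₁ - U₂`, `z_{--+} = -U₀ - U₁ + U₂`.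

* `prod_sub_eq_quartic` — **`∏_ε (z - z_ε) = z⁴ - 6c₄z² - 8c₆z - 3c₄² = Q(z)`** (any commutative
  ring), hence in a domain `Q(z) = 0 ↔ z ∈ {z_ε}` (`quartic_eq_zero_iff`);
* `twelve_mul_sub_sq_mul_eq` — the Bezout identity
  `(2c₆z - c₄z² + 3c₄²)(z³ - 3c₄z - 2c₆) + (c₄z - 2c₆) Q(z) = -12(c₄³ - c₆²) z` and its companions,
  whence **`Ψ₂Sq` and `Ψ₃` have no common root on an elliptic curve**
  (`Δ_eq_zero_of_eval_Ψ₂Sq_eq_zero_of_eval_Ψ₃_eq_zero`, characteristic `0`): the points of `E[3]`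
  are not `2`-torsion, `c₆ + Σ_k (c₄ + 6ωᵏδ)U_k ≠ 0`;
* `eval_Ψ₃_eq_zero_iff` — **the roots of `Ψ₃` are exactly the four `x_ε = (z_ε - b₂)/12`**;
* `three_smul_eq_zero_of_twelve_mul_add_eq` / `exists_sign_of_three_smul_eq_zero` — **an affine
  point `P = (x, y)` of an elliptic curve in characteristic `0` has `3P = O` iff `12x + b₂ = z_ε`
  for some `ε`**; and `108 (2y + a₁x + a₃)² = c₆ + Σ_k ε_k(c₄ + 6ωᵏδ)U_k ≠ 0` there.

Applied to `V = W_{K̄}` (`geomPoints W`), this lists the eight non-zero points of the geometric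
`3`-torsion `geomTorsion W 3` by radicals, the input of the ramification computations in
`K(x(E[3])) = K(ω, δ, U₀, U₁, U₂)` and `K(E[3]) = K(x(E[3]))(2y_P + a₁x_P + a₃)`.

## References

* J. H. Silverman, *The Arithmetic of Elliptic Curves*, 2nd ed. (2009), III.1–III.2, Exercise 3.7
  (`ψ₂, ψ₃`; `[3]P = O ↔ ψ₃(P) = 0` for `2P ≠ O`). [SilvermanAEC2009]
* J. H. Silverman, *Advanced Topics in the Arithmetic of Elliptic Curves*, GTM 151 (1994), §IV.10
  (`L = K(E[ℓ])`), IV.11.1. [SilvermanATAEC1994]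

## Design

Theorems only.  §1 over a commutative ring / domain; §2 over a field of characteristic `0` with
the tree's `three_smul_some_eq_zero_iff`, `two_smul_some_eq_zero_iff` (`DivisionPolynomialTorsion`)
and Mathlib's `ψ_three`, `Affine.equation_iff_nonsingular`.  Axioms: `propext`, `Classical.choice`,
`Quot.sound`.
-/

open Polynomial
open scoped Classical

namespace Literature.NumberTheory.EllipticCurves.ThreeTorsionRadicals

section Ring

variable {R : Type*} [CommRing R] {c₄ c₆ δ ω U₀ U₁ U₂ : R}

/-- **`∏_ε (z - z_ε) = Q(z) = z⁴ - 6c₄z² - 8c₆z - 3c₄²`**: the four `z_ε = ±U₀ ± U₁ ± U₂` (even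
number of minus signs) are the roots of the `3`-division quartic. [folklore] -/
theorem prod_sub_eq_quartic (hω : ω ^ 2 + ω + 1 = 0) (h₀ : U₀ ^ 2 = c₄ - 12 * δ)
    (h₁ : U₁ ^ 2 = c₄ - 12 * ω * δ) (h₂ : U₂ ^ 2 = c₄ - 12 * ω ^ 2 * δ)
    (hp : U₀ * U₁ * U₂ = c₆) (z : R) :
    (z - (U₀ + U₁ + U₂)) * (z - (U₀ - U₁ - U₂)) * (z - (-U₀ + U₁ - U₂)) * (z - (-U₀ - U₁ + U₂))
      = z ^ 4 - 6 * c₄ * z ^ 2 - 8 * c₆ * z - 3 * c₄ ^ 2 := by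
  linear_combination (U₀ ^ 2 + (c₄ - 12 * δ) - 2 * z ^ 2 - 2 * U₁ ^ 2 - 2 * U₂ ^ 2) * h₀
    + (U₁ ^ 2 + (c₄ - 12 * ω * δ) - 2 * U₂ ^ 2 - 2 * (z ^ 2 + (c₄ - 12 * δ))) * h₁
    + (U₂ ^ 2 + (c₄ - 12 * ω ^ 2 * δ) - 2 * (c₄ - 12 * ω * δ) - 2 * (z ^ 2 + (c₄ - 12 * δ))) * h₂
    + (-8 * z) * hp
    + (24 * δ * z ^ 2 - 12 * δ * ((c₄ - 12 * δ) + (c₄ - 12 * ω * δ) + (c₄ - 12 * ω ^ 2 * δ) + 3 * c₄)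
        + 96 * c₄ * δ - 576 * δ ^ 2 * ω) * hω

/-- In a domain: **`Q(z) = 0 ↔ z ∈ {z_ε}`**. [folklore] -/
theorem quartic_eq_zero_iff [IsDomain R] (hω : ω ^ 2 + ω + 1 = 0) (h₀ : U₀ ^ 2 = c₄ - 12 * δ)
    (h₁ : U₁ ^ 2 = c₄ - 12 * ω * δ) (h₂ : U₂ ^ 2 = c₄ - 12 * ω ^ 2 * δ)
    (hp : U₀ * U₁ * U₂ = c₆) (z : R) :
    z ^ 4 - 6 * c₄ * z ^ 2 - 8 * c₆ * z - 3 * c₄ ^ 2 = 0 ↔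
      z = U₀ + U₁ + U₂ ∨ z = U₀ - U₁ - U₂ ∨ z = -U₀ + U₁ - U₂ ∨ z = -U₀ - U₁ + U₂ := by
  rw [← prod_sub_eq_quartic hω h₀ h₁ h₂ hp z]
  simp only [mul_eq_zero, sub_eq_zero, or_assoc]

/-- **Bezout between the cubic `F(z) = z³ - 3c₄z - 2c₆` and the quartic `Q(z)`**:
`(2c₆z - c₄z² + 3c₄²) F(z) + (c₄z - 2c₆) Q(z) = -12 (c₄³ - c₆²) z`. [folklore] -/
theorem bezout_cubic_quartic (c₄ c₆ z : R) :
    (2 * c₆ * z - c₄ * z ^ 2 + 3 * c₄ ^ 2) * (z ^ 3 - 3 * c₄ * z - 2 * c₆)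
      + (c₄ * z - 2 * c₆) * (z ^ 4 - 6 * c₄ * z ^ 2 - 8 * c₆ * z - 3 * c₄ ^ 2)
      = -12 * (c₄ ^ 3 - c₆ ^ 2) * z := by
  ring

/-- `3 (c₄z² + 2c₆z + c₄²) = z F(z) - Q(z)`. [folklore] -/
theorem three_mul_quadratic_eq (c₄ c₆ z : R) :
    3 * (c₄ * z ^ 2 + 2 * c₆ * z + c₄ ^ 2) =
      z * (z ^ 3 - 3 * c₄ * z - 2 * c₆) - (z ^ 4 - 6 * c₄ * z ^ 2 - 8 * c₆ * z - 3 * c₄ ^ 2) := by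
  ring

/-- **A common root of `F` and `Q` forces `c₄³ = c₆²`** in a domain of characteristic `0`
(`12 ≠ 0`, `3 ≠ 0`, `2 ≠ 0`): from the Bezout identity `(c₄³ - c₆²) z = 0`; if `c₄³ ≠ c₆²` then
`z = 0`, then `c₄² = 0` from the quadratic and `c₆ = 0` from the cubic. [folklore] -/
theorem cube_eq_sq_of_common_root [IsDomain R] [CharZero R] {c₄ c₆ z : R}
    (hF : z ^ 3 - 3 * c₄ * z - 2 * c₆ = 0)
    (hQ : z ^ 4 - 6 * c₄ * z ^ 2 - 8 * c₆ * z - 3 * c₄ ^ 2 = 0) : c₄ ^ 3 = c₆ ^ 2 := by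
  by_contra hne
  have hD : c₄ ^ 3 - c₆ ^ 2 ≠ 0 := sub_ne_zero.mpr hne
  have hz : -12 * (c₄ ^ 3 - c₆ ^ 2) * z = 0 := by
    rw [← bezout_cubic_quartic c₄ c₆ z, hF, hQ, mul_zero, mul_zero, add_zero]
  have hz0 : z = 0 := by
    rcases mul_eq_zero.mp hz with h | h
    · exact absurd h (mul_ne_zero (by norm_num) hD)
    · exact h
  have hq : 3 * (c₄ * z ^ 2 + 2 * c₆ * z + c₄ ^ 2) = 0 := by
    rw [three_mul_quadratic_eq, hF, hQ]; ring
  rw [hz0] at hq hF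
  have hc₄ : c₄ = 0 := by
    have : (3 : R) * c₄ ^ 2 = 0 := by linear_combination hq
    exact pow_eq_zero_iff (n := 2) (by norm_num) |>.mp
      ((mul_eq_zero.mp this).resolve_left (by norm_num))
  have hc₆ : c₆ = 0 := by
    have : (-2 : R) * c₆ = 0 := by linear_combination hF
    exact (mul_eq_zero.mp this).resolve_left (by norm_num)
  exact hne (by rw [hc₄, hc₆]; ring)

end Ring

end Literature.NumberTheory.EllipticCurves.ThreeTorsionRadicals

namespace WeierstrassCurve

open Literature.NumberTheory.EllipticCurves.ThreeTorsionRadicals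

section Field

variable {F : Type*} [Field F] (V : WeierstrassCurve F)

/-- **`Ψ₂Sq` and `Ψ₃` have no common root on an elliptic curve (characteristic `0`)**: a common
root `x` gives, at `z = 12x + b₂`, a common root of `z³ - 3c₄z - 2c₆ = 432 Ψ₂Sq(x)` and
`Q(z) = 12⁴Ψ₃(x)/3`, hence `c₄³ = c₆²`, i.e. `1728 Δ = 0`.  Silverman, *AEC* III, Ex. 3.7 (the
points of order `3` are not of order `2`). [cite: SilvermanAEC2009, Exercise 3.7] -/
theorem Δ_eq_zero_of_eval_Ψ₂Sq_eq_zero_of_eval_Ψ₃_eq_zero [CharZero F] {x : F}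
    (h₂ : V.Ψ₂Sq.eval x = 0) (h₃ : V.Ψ₃.eval x = 0) : V.Δ = 0 := by
  have hF : (12 * x + V.b₂) ^ 3 - 3 * V.c₄ * (12 * x + V.b₂) - 2 * V.c₆ = 0 := by
    rw [← V.mul_Ψ₂Sq_eval_eq x, h₂, mul_zero]
  have hQ : (12 * x + V.b₂) ^ 4 - 6 * V.c₄ * (12 * x + V.b₂) ^ 2 - 8 * V.c₆ * (12 * x + V.b₂)
      - 3 * V.c₄ ^ 2 = 0 := by
    have e := V.twelve_pow_four_mul_eval_Ψ₃ x
    rw [h₃, mul_zero] at e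
    have : (3 : F) ≠ 0 := by norm_num
    exact (mul_eq_zero.mp e.symm).resolve_left this
  have hc := cube_eq_sq_of_common_root hF hQ
  have e := V.c_relation
  have : (1728 : F) * V.Δ = 0 := by rw [e, hc, sub_self]
  exact (mul_eq_zero.mp this).resolve_left (by norm_num)

variable {V}
variable {δ ω U₀ U₁ U₂ : F}

/-- **The roots of `Ψ₃` by radicals (characteristic `0`)**: `Ψ₃(x) = 0` iff
`12x + b₂ ∈ {U₀ + U₁ + U₂, U₀ - U₁ - U₂, -U₀ + U₁ - U₂, -U₀ - U₁ + U₂}`. [folklore] -/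
theorem eval_Ψ₃_eq_zero_iff [CharZero F] (hω : ω ^ 2 + ω + 1 = 0)
    (h₀ : U₀ ^ 2 = V.c₄ - 12 * δ) (h₁ : U₁ ^ 2 = V.c₄ - 12 * ω * δ)
    (h₂ : U₂ ^ 2 = V.c₄ - 12 * ω ^ 2 * δ) (hp : U₀ * U₁ * U₂ = V.c₆) (x : F) :
    V.Ψ₃.eval x = 0 ↔
      12 * x + V.b₂ = U₀ + U₁ + U₂ ∨ 12 * x + V.b₂ = U₀ - U₁ - U₂ ∨
        12 * x + V.b₂ = -U₀ + U₁ - U₂ ∨ 12 * x + V.b₂ = -U₀ - U₁ + U₂ := by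
  rw [← quartic_eq_zero_iff hω h₀ h₁ h₂ hp]
  constructor
  · intro h
    have e := V.twelve_pow_four_mul_eval_Ψ₃ x
    rw [h, mul_zero] at e
    exact (mul_eq_zero.mp e.symm).resolve_left (by norm_num)
  · intro h
    have e := V.twelve_pow_four_mul_eval_Ψ₃ x
    rw [h, mul_zero] at e
    exact (mul_eq_zero.mp e).resolve_left (by norm_num)

/-- **The quadratic layer is non-trivial**: at a root `x` of `Ψ₃` of an elliptic curve
(characteristic `0`), `Ψ₂Sq(x) ≠ 0`, i.e. with `12x + b₂ = U₀ + U₁ + U₂`,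
`c₆ + Σ_k (c₄ + 6ωᵏδ)U_k ≠ 0`. [folklore] -/
theorem radicalTheta_ne_zero [CharZero F] [V.IsElliptic] (hω : ω ^ 2 + ω + 1 = 0)
    (h₀ : U₀ ^ 2 = V.c₄ - 12 * δ) (h₁ : U₁ ^ 2 = V.c₄ - 12 * ω * δ)
    (h₂ : U₂ ^ 2 = V.c₄ - 12 * ω ^ 2 * δ) (hp : U₀ * U₁ * U₂ = V.c₆) :
    V.c₆ + (V.c₄ + 6 * δ) * U₀ + (V.c₄ + 6 * ω * δ) * U₁ + (V.c₄ + 6 * ω ^ 2 * δ) * U₂ ≠ 0 := by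
  intro hΘ
  -- the root `x = (U₀ + U₁ + U₂ - b₂)/12`
  set x : F := (U₀ + U₁ + U₂ - V.b₂) / 12 with hx
  have hx12 : 12 * x + V.b₂ = U₀ + U₁ + U₂ := by
    rw [hx]; field_simp; ring
  have h2 : IsUnit (2 : F) := isUnit_iff_ne_zero.mpr (by norm_num)
  have hΨ₂ : V.Ψ₂Sq.eval x = 0 := by
    have e := V.mul_Ψ₂Sq_eval_eq_of_twelve_mul_add_eq h2 hω h₀ h₁ h₂ hp hx12
    rw [hΘ] at e
    exact (mul_eq_zero.mp e).resolve_left (by norm_num)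
  have hΨ₃ : V.Ψ₃.eval x = 0 := (eval_Ψ₃_eq_zero_iff hω h₀ h₁ h₂ hp x).mpr (Or.inl hx12)
  exact V.isUnit_Δ.ne_zero (V.Δ_eq_zero_of_eval_Ψ₂Sq_eq_zero_of_eval_Ψ₃_eq_zero hΨ₂ hΨ₃)

/-- **`3P = O` for `P = (x, y)` with `12x + b₂ = U₀ + U₁ + U₂`** (elliptic curve, characteristic
`0`): `Ψ₃(x) = 0` and `P` is not `2`-torsion (`Ψ₂Sq(x) ≠ 0`), so Mathlib's/the tree's
`three_smul_some_eq_zero_iff` applies.  Silverman, *AEC* III, Ex. 3.7.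
[cite: SilvermanAEC2009, Exercise 3.7] -/
theorem three_smul_eq_zero_of_twelve_mul_add_eq [CharZero F] [V.IsElliptic]
    (hω : ω ^ 2 + ω + 1 = 0) (h₀ : U₀ ^ 2 = V.c₄ - 12 * δ) (h₁ : U₁ ^ 2 = V.c₄ - 12 * ω * δ)
    (h₂ : U₂ ^ 2 = V.c₄ - 12 * ω ^ 2 * δ) (hp : U₀ * U₁ * U₂ = V.c₆) {x y : F}
    (h : V.toAffine.Nonsingular x y) (hx : 12 * x + V.b₂ = U₀ + U₁ + U₂) :
    (3 : ℤ) • (Affine.Point.some x y h : V.toAffine.Point) = 0 := by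
  have h2 : IsUnit (2 : F) := isUnit_iff_ne_zero.mpr (by norm_num)
  have hsq := V.mul_sq_two_mul_add_eq h2 hω h₀ h₁ h₂ hp h.left hx
  have hΘ := radicalTheta_ne_zero (V := V) hω h₀ h₁ h₂ hp
  have hy : y ≠ V.toAffine.negY x y := by
    intro hy
    apply hΘ
    rw [← hsq]
    have : 2 * y + V.a₁ * x + V.a₃ = 0 := by
      rw [Affine.negY] at hy
      linear_combination hy
    rw [this]; ring
  rw [three_smul_some_eq_zero_iff h hy, ψ_three, evalEval_C]
  exact (eval_Ψ₃_eq_zero_iff hω h₀ h₁ h₂ hp x).mpr (Or.inl hx)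

/-- **Every point of order `3` is given by the radicals**: if `3P = O` for an affine point
`P = (x, y)` of an elliptic curve in characteristic `0`, then `12x + b₂ = ±U₀ ± U₁ ± U₂` with an
even number of minus signs.  Silverman, *AEC* III, Ex. 3.7. [cite: SilvermanAEC2009, Exercise 3.7] -/
theorem exists_sign_of_three_smul_eq_zero [CharZero F] [V.IsElliptic]
    (hω : ω ^ 2 + ω + 1 = 0) (h₀ : U₀ ^ 2 = V.c₄ - 12 * δ) (h₁ : U₁ ^ 2 = V.c₄ - 12 * ω * δ)
    (h₂ : U₂ ^ 2 = V.c₄ - 12 * ω ^ 2 * δ) (hp : U₀ * U₁ * U₂ = V.c₆) {x y : F}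
    (h : V.toAffine.Nonsingular x y)
    (h3 : (3 : ℤ) • (Affine.Point.some x y h : V.toAffine.Point) = 0) :
    12 * x + V.b₂ = U₀ + U₁ + U₂ ∨ 12 * x + V.b₂ = U₀ - U₁ - U₂ ∨
      12 * x + V.b₂ = -U₀ + U₁ - U₂ ∨ 12 * x + V.b₂ = -U₀ - U₁ + U₂ := by
  -- `P` is not `2`-torsion: otherwise `P = 3P - 2P = O`
  have hy : y ≠ V.toAffine.negY x y := by
    intro hy
    have h2 : (2 : ℤ) • (Affine.Point.some x y h : V.toAffine.Point) = 0 := by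
      rw [two_zsmul, add_eq_zero_iff_eq_neg, Affine.Point.neg_some]
      congr 1
    have h1 : (1 : ℤ) • (Affine.Point.some x y h : V.toAffine.Point) = 0 := by
      have : (1 : ℤ) = 3 - 2 := by norm_num
      rw [this, sub_zsmul, h3, h2]; simp
    rw [one_zsmul] at h1
    exact Affine.Point.some_ne_zero h h1
  have hΨ : V.Ψ₃.eval x = 0 := by
    have := (three_smul_some_eq_zero_iff h hy).mp h3
    rwa [ψ_three, evalEval_C] at this
  exact (eval_Ψ₃_eq_zero_iff hω h₀ h₁ h₂ hp x).mp hΨ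

/-- **Existence of the eight points over an algebraically closed field of characteristic `0`**:
radicals `ω, δ, U₀, U₁, U₂` (`δ³ = Δ`) and, for the sign pattern `(+++)`, a point `P = (x, y)`
with `12x + b₂ = U₀ + U₁ + U₂`, `3P = O`, `P ≠ O`; the other patterns follow by the sign
changes, the opposite points by `y ↦ -y - a₁x - a₃`. [folklore] -/
theorem exists_radicals_point [IsAlgClosed F] [CharZero F] [V.IsElliptic] :
    ∃ ω δ U₀ U₁ U₂ : F, ω ^ 2 + ω + 1 = 0 ∧ δ ^ 3 = V.Δ ∧ U₀ ^ 2 = V.c₄ - 12 * δ ∧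
      U₁ ^ 2 = V.c₄ - 12 * ω * δ ∧ U₂ ^ 2 = V.c₄ - 12 * ω ^ 2 * δ ∧ U₀ * U₁ * U₂ = V.c₆ ∧
      ∃ (x y : F) (h : V.toAffine.Nonsingular x y), 12 * x + V.b₂ = U₀ + U₁ + U₂ ∧
        (3 : ℤ) • (Affine.Point.some x y h : V.toAffine.Point) = 0 := by
  obtain ⟨ω, δ, U₀, U₁, U₂, hω, hδ, h₀, h₁, h₂, hp⟩ :=
    exists_radicals (F := F) V.c₄ V.c₆ V.Δ V.c_relation
  set x : F := (U₀ + U₁ + U₂ - V.b₂) / 12 with hx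
  have hx12 : 12 * x + V.b₂ = U₀ + U₁ + U₂ := by
    rw [hx]; field_simp; ring
  obtain ⟨y, hy⟩ := V.exists_equation x
  have hns : V.toAffine.Nonsingular x y := Affine.equation_iff_nonsingular.mp hy
  exact ⟨ω, δ, U₀, U₁, U₂, hω, hδ, h₀, h₁, h₂, hp, x, y, hns, hx12,
    three_smul_eq_zero_of_twelve_mul_add_eq hω h₀ h₁ h₂ hp hns hx12⟩

end Field

end WeierstrassCurve
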